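import Summits.ResolutionOfSingularities.ResolutionOfSingularities.Theorems.EquisingularLiftEquisingularLiftNatHostTransportPointStep
import Summits.ResolutionOfSingularities.ResolutionOfSingularities.Theorems.EquisingularLiftEquisingularLiftNatTowerInvBFourDefs
import HarnessLib

/-!
# [OURS · L1 W4.5(b) · EL♮(3) · WIDTH TABLE D17 «STAGE-0 TOWER BOOKKEEPING», engine brick (n1)] `Tower.exc₄_transport_through`
# — a MODEL-CARRYING member of `E :: Es` through a `(pt-reg)` point step WHOSE POINT LIES ON IT keeps its model: the strict transform of the
# member's O-model `𝓕` under the blow-up `τ` of the upstairs section `ỹ ⊂ V(𝓕)` through the point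

res-L1-w45b-stub-4 g16 (STUB WORKER 4; desk RULING R81 (2) / g27-10 / g27-12 of 2026-08-29: «stub-4 g16 = (n1) `Tower.exc₄_transport_through` + (n2)»;
sizing res-L1-w45b-idea-2 g31 `D17-SIZING-idea2.md` c53e9159a56ae8bd §2 (E-b) / §6 (n1); letter ✓ res-type-027 `…NatResidueHypDefsE9` p719436
`TowerPtRegB₅` (T1): the third E-arm / first `Es'`-arm «`E' = closure υ₂⁻¹(F ∖ {y})`» WITHOUT `y ∉ F`).  Crux EL♮(3) = stmt-ResolutionOfSingularities-20148
(parent EL♮ stmt-…-20038; bookkeeping crux stmt-…-15660).  OURS; NOT a statement of any manuscript ([Hironaka2017] is a candidate under adjudication,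
nothing of it is asserted); AI-written, weaker than expert review.  DEF-FREE; no `sorry`; standard axioms; `--supports stmt-…-20148 --as helper`, counted 0.

WHAT.  In the `(pt-reg)` model square of res-L1-w45b-stub-4 / res-type-027's point steps — upstairs stage `(X, σ)` over `q`, special fibre
`jG : G ⟶ X` (pull-back of `Spec k → Spec O`), a SECTION `ỹ = s : Spec O ⟶ X` through `jG pt`, `τ = Bl_{ker s} : X'' ⟶ X`, downstairs `υ₂ = Bl_pt : G' ⟶ G`,
`j₂ ≫ τ = υ₂ ≫ jG`, `(ker s)·𝒪_G = 𝓘⟨{pt}⟩` — a member `F ∋ pt` whose O-model `𝓕` CONTAINS THE SECTION (`𝓕 ≤ ker s`: the constrained point-lift (n2))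
is carried to `St F := closure υ₂⁻¹(F ∖ {pt})` WITH THE MODEL `St_τ 𝓕 := strictTransformIdeal τ (ker s) 𝓕` in the new stage `(X'', τ ≫ σ, j₂)`:
* `Tower.exc₄_transport_through` — INPUT the member's model clauses (exact reduced trace `𝓕·𝒪_G = 𝓘⟨F⟩`, stalkwise principal, `V(𝓕)` regular, off the
  generic point of `Y`, the ruled datum `Ruled … 𝓕`) + `𝓕 ≤ ker s` + `𝓕 ≠ ⊥`; OUTPUT `Tower.Exc₄ … G' (υ₂ ≫ γ) (closure υ₂⁻¹(F ∖ {pt})) hF' ∅ X'' (τ ≫ σ) j₂`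
  (shadow forgotten); the ruled datum follows strict transforms through the binder `hRuledSt` exactly as in ✓ `Tower.exc₄_transport_transversal'`
  (…NatTowerBTransportFour).  Regular + principal + `≠ ⊥` = res-type-027's ✓ `member_clause_iii_strictTransform_section` (pair `(𝓕, 𝓕)`); exact trace =
  my ✓ (HT1) `comap_strictTransformIdeal_host_eq_of_nestedSection` (…NatHostTransportPointStep p659650: section frame + the ORDER-ONE linear form of the
  member's equation at `jG pt`, `exists_generator_not_mem_sq_of_isRegular_subscheme`) + ✓ `strictTransformIdeal_vanishingIdeal_eq`.
* `Tower.exc₄_transport_through_FE` — the same at the engine's datum `FE := «V(𝓔) is O-flat»` (flatness of strict transforms: res-L1-w45b-stub-2's ✓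
  `flat_strictTransform_subschemeι_comp_stage`).
WHY THE SECTION MUST LIE ON THE MODEL (flag l.38554, by type): an O-point of the regular O-flat `V(𝓕)` over `pt` exists iff `V(𝓕)` is O-smooth at `jG pt`
iff the reduced trace `F̃` is regular at `pt` (`V(xy − t)` has none through the origin) — that hypothesis lives in the LETTER (re-type E9′), the section is
then res-L1-w45b-stub-4's nested Hensel section (✓ `exists_nested_section_closedImmersion`, brick (n2)); this file is the transport AFTER the section is chosen.
[cite: GortzWedhorn2020, Prop. 13.91 and (13.19)] [cite: Matsumura1987, Thm. 14.2] (method; index only).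
-/

set_option linter.dupNamespace false -- mandated namespace `Summit.<Summit>.<Problem>` of this single-conjunct summit
set_option linter.overlappingInstances false -- the binders carry `[IsDomain O] [IsDiscreteValuationRing O]`

noncomputable section

open CategoryTheory CategoryTheory.Limits AlgebraicGeometry TopologicalSpace Topology IsLocalRing
open Literature.AlgebraicGeometry.Resolution
open AlgebraicGeometry.Scheme.IdealSheafData
open Summit.ResolutionOfSingularities.ResolutionOfSingularities.Theses.EquisingularLift.Split
open Summit.ResolutionOfSingularities.ResolutionOfSingularities.Cruxes.EquisingularLift.StrataSplit

namespace Summit.ResolutionOfSingularities.ResolutionOfSingularities.Cruxes.EquisingularLiftNat.Sections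

section Through

variable (O : Type) [CommRing O] [IsDomain O] [IsDiscreteValuationRing O] (k : Type) [Field k] (θ : O →+* k) (hθ : Function.Surjective θ)
  (P : Scheme.{0}) (q : P ⟶ Spec (.of O)) (Y : Set P) (Ruled : Tower.RuledDatum P)
  {F₉ : Scheme.{0}} {Z₉ : Set F₉} {hZ₉ : IsClosed Z₉} {F₁₀ : Scheme.{0}} {υ' : F₁₀ ⟶ F₉}
  {G G' X X'' : Scheme.{0}} {γ : G ⟶ F₁₀} {σ : X ⟶ P} {jG : G ⟶ X} {tG : G ⟶ Spec (.of k)}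
  [IsSeparated (σ ≫ q)] [IsLocallyNoetherian X] [IsIntegral X] [IsLocallyNoetherian X''] [IsLocallyNoetherian G] [IsIntegral G]
  [IsLocallyNoetherian G'] [IsIntegral G']
  (hXreg : Scheme.IsRegular X) (hsq : IsPullback jG tG (σ ≫ q) (Spec.map (CommRingCat.ofHom θ)))
  -- the section through `jG pt`, the two blow-ups and the model square
  (s : Spec (.of O) ⟶ X) (hs : s ≫ σ ≫ q = 𝟙 _) {τ : X'' ⟶ X} (hτ : IsBlowup τ s.ker)
  {pt : G} (hyc : IsClosed ({pt} : Set G)) {υ₂ : G' ⟶ G} (hυ₂ : IsBlowup υ₂ (vanishingIdeal ⟨{pt}, hyc⟩))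
  {j₂ : G' ⟶ X''} (hcomm : j₂ ≫ τ = υ₂ ≫ jG) (hJ : s.ker.comap jG = vanishingIdeal ⟨{pt}, hyc⟩) (hsx : s (closedPoint O) = jG pt)

include hθ hXreg hsq hs hτ hυ₂ hcomm hJ hsx

/-- **(n1) `Tower.exc₄_transport_through` — a MODEL-CARRYING member THROUGH a `(pt-reg)` point step keeps its model** when the upstairs centre, the
section `ỹ = s`, LIES ON the member's model (`𝓕 ≤ ker s`): the new model of `St F = closure υ₂⁻¹(F ∖ {pt})` in the stage `(X'', τ ≫ σ, j₂)` is the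
strict transform `St_τ 𝓕 = strictTransformIdeal τ (ker s) 𝓕` — regular and stalkwise principal (✓ `member_clause_iii_strictTransform_section`), exact reduced
trace (✓ HT1 `comap_strictTransformIdeal_host_eq_of_nestedSection` + ✓ `strictTransformIdeal_vanishingIdeal_eq`), off the generic point of `Y`
(`supp St_τ 𝓕 ⊆ τ⁻¹ supp 𝓕`), ruled datum by `hRuledSt`; shadow forgotten.  INPUT = the OPENED `Exc₄` clauses of the member (the section is chosen on a
given model, so the `∃ 𝓕` cannot stay closed) + `𝓕 ≤ ker s` + `𝓕 ≠ ⊥`.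
[cite: GortzWedhorn2020, Prop. 13.91 and (13.19)] [OURS · L1 W4.5b · D17 engine (n1)]; NOT a statement of the manuscript. -/
theorem Tower.exc₄_transport_through
    (hRuledSt : ∀ (F : Set G) (F' : Set G') (𝓕 : X.IdealSheafData), Ruled F₉ Z₉ hZ₉ F₁₀ υ' G γ F X σ jG 𝓕 →
      Ruled F₉ Z₉ hZ₉ F₁₀ υ' G' (υ₂ ≫ γ) F' X'' (τ ≫ σ) j₂ (strictTransformIdeal τ s.ker 𝓕))
    {F : Set G} (hF : IsClosed F) (𝓕 : X.IdealSheafData)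
    (he1 : 𝓕.comap jG = vanishingIdeal (⟨F, hF⟩ : Closeds G)) (he2 : ∀ z : X, (stalkIdeal 𝓕 z).IsPrincipal)
    (he3 : Scheme.IsRegular 𝓕.subscheme) (he4 : σ '' (𝓕.support : Set X) ⊆ {p : P | ¬ IsGenericPoint p Y})
    (he5 : Ruled F₉ Z₉ hZ₉ F₁₀ υ' G γ F X σ jG 𝓕) (hle : 𝓕 ≤ s.ker) (h0 : 𝓕 ≠ ⊥) :
    ∀ hF' : IsClosed (closure (υ₂ ⁻¹' (F \ {pt}))),
      Tower.Exc₄ O P q Y Ruled Z₉ hZ₉ υ' G' (υ₂ ≫ γ) (closure (υ₂ ⁻¹' (F \ {pt}))) hF' ∅ X'' (τ ≫ σ) j₂ := by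
  classical
  intro hF'
  have hs' : s ≫ (σ ≫ q) = 𝟙 _ := hs
  -- regular + principal + non-zero: 027's clause-(iii) stepping for the pair `(𝓕, 𝓕)`
  obtain ⟨⟨hreg', hpr'⟩, -⟩ := member_clause_iii_strictTransform_section O (σ ≫ q) s hs' hXreg hτ 𝓕 𝓕 (by rw [sup_idem]; exact hle) h0
    ⟨he3, fun z => ⟨he2 z, he2 z⟩⟩
  refine ⟨strictTransformIdeal τ s.ker 𝓕, ?_, fun z => (hpr' z).1, hreg', ?_, hRuledSt F _ 𝓕 he5, Or.inl rfl⟩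
  · -- (e-i) the exact reduced trace `St_τ 𝓕 · 𝒪_{G'} = 𝓘⟨closure υ₂⁻¹(F ∖ {pt})⟩`: the member's equation at `jG pt` has order one (`V(𝓕)` regular there)
    have hxmem : jG pt ∈ 𝓕.support := by
      have hx' : pt ∈ ((vanishingIdeal (⟨{pt}, hyc⟩ : Closeds G)).support : Set G) := by
        rw [Scheme.IdealSheafData.coe_support_vanishingIdeal]; exact Set.mem_singleton pt
      rw [← hJ, Scheme.IdealSheafData.support_comap] at hx'
      exact Scheme.IdealSheafData.support_antitone hle hx'
    obtain ⟨ϖ, hϖ⟩ := IsDiscreteValuationRing.exists_irreducible O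
    obtain ⟨h, h𝓕h, hh2⟩ := exists_generator_not_mem_sq_of_isRegular_subscheme hXreg he3 he2 h0 (jG pt) hxmem
    rw [comap_strictTransformIdeal_host_eq_of_nestedSection O k θ hθ (σ ≫ q) jG tG hsq s hs' τ hτ υ₂ j₂ hcomm pt hyc hυ₂ hJ hsx (hXreg (jG pt))
      ϖ hϖ 𝓕 hle h𝓕h hh2, he1, strictTransformIdeal_vanishingIdeal_eq υ₂ _ hυ₂]
    congr 1
  · -- (e-iv) off the generic point of `Y`: `supp St_τ 𝓕 ⊆ τ⁻¹ supp 𝓕`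
    rintro _ ⟨z, hz, rfl⟩
    rw [Scheme.Hom.comp_apply]
    exact he4 ⟨τ z, apply_mem_support_of_mem_support_strictTransformIdeal 𝓕 hz, rfl⟩

/-- **(n1) at the engine's datum `FE`** («`V(𝓔)` is O-flat», carrier-free): strict transforms of O-flat closed subschemes under blow-ups stay O-flat
(res-L1-w45b-stub-2's ✓ T-STFLAT-GEN `flat_strictTransform_subschemeι_comp_stage`). [OURS · L1 W4.5b · D17 engine (n1)]; NOT a statement of the manuscript. -/
theorem Tower.exc₄_transport_through_FE
    {F : Set G} (hF : IsClosed F) (𝓕 : X.IdealSheafData)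
    (he1 : 𝓕.comap jG = vanishingIdeal (⟨F, hF⟩ : Closeds G)) (he2 : ∀ z : X, (stalkIdeal 𝓕 z).IsPrincipal)
    (he3 : Scheme.IsRegular 𝓕.subscheme) (he4 : σ '' (𝓕.support : Set X) ⊆ {p : P | ¬ IsGenericPoint p Y})
    (he5 : Flat (𝓕.subschemeι ≫ σ ≫ q)) (hle : 𝓕 ≤ s.ker) (h0 : 𝓕 ≠ ⊥) :
    ∀ hF' : IsClosed (closure (υ₂ ⁻¹' (F \ {pt}))),
      Tower.Exc₄ O P q Y (fun _ _ _ _ _ _ _ _ _ σ₀ _ 𝓔 => Flat (𝓔.subschemeι ≫ σ₀ ≫ q)) Z₉ hZ₉ υ' G' (υ₂ ≫ γ) (closure (υ₂ ⁻¹' (F \ {pt}))) hF' ∅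
        X'' (τ ≫ σ) j₂ :=
  Tower.exc₄_transport_through O k θ hθ P q Y _ hXreg hsq s hs hτ hyc hυ₂ hcomm hJ hsx
    (fun _ _ 𝓕₀ h => flat_strictTransform_subschemeι_comp_stage O σ q τ s.ker hτ 𝓕₀ h) hF 𝓕 he1 he2 he3 he4 he5 hle h0

end Through

end Summit.ResolutionOfSingularities.ResolutionOfSingularities.Cruxes.EquisingularLiftNat.Sections

end
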